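import Mathlib
import Summits.Ventures.HodgeRepro.Tier4.Line4.ProjectedTest
import Summits.Ventures.HodgeRepro.Tier4.Line4.ProjectedTestList
import Summits.Ventures.HodgeRepro.Tier4.Line4.StabilityOfProjected
import Summits.Ventures.HodgeRepro.Tier4.Line1.RTFSetting

/-!
# Tier4/Line4/ProjectedTestL1 — THE `L¹` TWIN of `isTestFn_projTest` / `isTest_biProjList`: the `(τ′,K)`-projectors
preserve «continuous and integrable» (C-L4-PROJL1)

Blind re-derivation cell `pub-hodge-repro`, Tier 4 (README §9–§10), seat t4-L1-p2 (gen 4), re-pointed to LINE L4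
(lead g386 S14632 (R-4), t4-plan-4 g4's cut C-L4-PROJL1 S14762, TAKEN S14764).  Target tree path
`lean/Summits/Ventures/HodgeRepro/Tier4/Line4/ProjectedTestL1.lean`.  Imports t4-L4-p2's `ProjectedTest` (`kProj`,
`kProjL`, `kProjL_apply`, `biProj`), `ProjectedTestList` (`ProjDatum`, `ProjDatum.Good`, `biProjList`),
`StabilityOfProjected` (`projData`, `projTest`) and through them t4-typer's `KTypeProjector` (`continuous_kProj`)
and `Line1.RTFSetting` (`RTF.Setting`: `haar`, `rightInv`).  0 print.

WHAT IS PROVED.  (i) **`integrable_kProj`**: for `C` compact, `ν` finite, `χ` continuous on `C`, `f` continuous and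
integrable for the Haar measure `S.μ`, the right projector `e_{C,χ} f = ∫_C conj χ(κ) f(· κ) dν` is integrable —
Fubini on `S.μ.prod ν` (`integrable_prod_iff'`): the sections `x ↦ conj χ(κ) f(x κ)` are integrable by the RIGHT
invariance of the Haar measure (`S.rightInv`, `Integrable.comp_mul_right`), and `κ ↦ ∫ ‖conj χ(κ) f(x κ)‖ dμ(x) =
‖χ κ‖ · ‖f‖₁` (`integral_mul_right_eq_self`) is continuous on the compact `C`, hence `ν`-integrable; then
`Integrable.integral_prod_left`.  (ii) **`integrable_kProjL`**: the left projector `e^L_{C,χ} f (x) = ∫_C conj χ(κ)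
f(κ⁻¹ x) dν` (`kProjL_apply`) by the same Fubini with the LEFT invariance (`S.haar`, `Integrable.comp_mul_left`,
`integral_mul_left_eq_self`) — no inversion invariance of `S.μ` is needed; `continuous_kProjL` beside it.
(iii) **`isTestL1_biProj`** and **`isTestL1_biProjList`**: «continuous and integrable» passes through `biProj` and
through the composite along a list of good data (induction as `isTest_biProjList`).  (iv) **`isTestL1_projTest`** on
`GA W`: the `(τ′,K)`-projected `f` of a continuous integrable `f` is continuous and integrable (the instance's
`secondCountable_GA` / `locallyCompact_GA` as in `isTestFn_projTest`) — «`projTest f₁ ∈ L¹`», the input of the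
§15 wall proof's `RtfSpectralL1` / `D3CoeffData` (the product shape is L4-p2's `isProductFn_projTest`).
INSTANCES beyond the cut's statement: `[SecondCountableTopology G]` (the joint measurability of `(x, κ) ↦ χ κ · f (x κ)`
on `G × C`: `Prod.opensMeasurableSpace` needs one factor second countable) and `[SFinite S.μ]` (`integrable_prod_iff'`);
both hold on the instance (`secondCountable_GA`, the Haar measure of a σ-compact group).

Nothing here says anything about the status of the Hodge conjecture for CM abelian varieties, which is NOT proved
(HC_CM is NOT proved by anyone in this repository).
-/

set_option autoImplicit false

noncomputable section

namespace Summit.Ventures.HodgeRepro.Tier4.Line4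

open Summit.Ventures.HodgeRepro.Tier4.Common Summit.Ventures.HodgeRepro.Tier4.Line1 MeasureTheory Topology
  NumberField
open scoped ComplexConjugate

section Projector

variable {G : Type} [Group G] [TopologicalSpace G] [IsTopologicalGroup G] [MeasurableSpace G] [BorelSpace G]
  (S : RTF.Setting G) (C : Subgroup G) (ν : Measure C)

omit [IsTopologicalGroup G] in
/-- a continuous function on the compact group `C` is `ν`-integrable (`ν` finite). -/
theorem integrable_of_continuous_compact [CompactSpace C] [IsFiniteMeasure ν] {φ : C → ℝ} (hφ : Continuous φ) :
    Integrable φ ν :=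
  integrableOn_univ.1 (hφ.continuousOn.integrableOn_compact' isCompact_univ MeasurableSet.univ)

/-- **the right projector preserves integrability**: `e_{C,χ} f` of a continuous integrable `f` is integrable
(Fubini on `S.μ.prod ν`, right invariance of the Haar measure). -/
theorem integrable_kProj [SecondCountableTopology G] [SFinite S.μ] [CompactSpace C] [IsFiniteMeasure ν]
    {χ : G → ℂ} (hχc : Continuous fun κ : C => χ κ) {f : G → ℂ} (hf : Continuous f) (hint : Integrable f S.μ) :
    Integrable (kProj C ν χ f) S.μ := by
  haveI : S.μ.IsMulRightInvariant := S.rightInv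
  have hFc : Continuous fun p : G × C => conj (χ p.2) * f (p.1 * p.2) :=
    (Complex.continuous_conj.comp (hχc.comp continuous_snd)).mul
      (hf.comp (continuous_fst.mul (continuous_subtype_val.comp continuous_snd)))
  have hFint : Integrable (fun p : G × C => conj (χ p.2) * f (p.1 * p.2)) (S.μ.prod ν) := by
    rw [integrable_prod_iff' hFc.aestronglyMeasurable]
    refine ⟨Filter.Eventually.of_forall fun κ => ?_, ?_⟩
    · show Integrable (fun x => conj (χ κ) * f (x * κ)) S.μ
      exact (hint.comp_mul_right (κ : G)).const_mul _
    · have h : (fun κ : C => ∫ x, ‖conj (χ κ) * f (x * κ)‖ ∂S.μ) = fun κ : C => ‖χ κ‖ * ∫ x, ‖f x‖ ∂S.μ := by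
        funext κ
        simp only [norm_mul, RCLike.norm_conj]
        rw [integral_const_mul]
        congr 1
        exact integral_mul_right_eq_self (fun x => ‖f x‖) (κ : G)
      rw [h]
      exact integrable_of_continuous_compact C ν (hχc.norm.mul continuous_const)
  exact hFint.integral_prod_left

omit [TopologicalSpace G] [IsTopologicalGroup G] [BorelSpace G] in
/-- the left projector unfolded as `∫_C conj χ(κ) f(κ⁻¹ x) dν`. -/
theorem kProjL_eq (χ f : G → ℂ) : kProjL C ν χ f = fun x => ∫ κ : C, conj (χ κ) * f ((κ : G)⁻¹ * x) ∂ν := by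
  funext x
  rw [kProjL_apply]
  congr 1
  funext κ
  rw [mul_inv_rev, inv_inv]

/-- **the left projector preserves integrability** (Fubini with the left invariance of the Haar measure). -/
theorem integrable_kProjL [SecondCountableTopology G] [SFinite S.μ] [CompactSpace C] [IsFiniteMeasure ν]
    {χ : G → ℂ} (hχc : Continuous fun κ : C => χ κ) {f : G → ℂ} (hf : Continuous f) (hint : Integrable f S.μ) :
    Integrable (kProjL C ν χ f) S.μ := by
  haveI : S.μ.IsHaarMeasure := S.haar
  have hFc : Continuous fun p : G × C => conj (χ p.2) * f ((p.2 : G)⁻¹ * p.1) :=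
    (Complex.continuous_conj.comp (hχc.comp continuous_snd)).mul
      (hf.comp ((continuous_subtype_val.comp continuous_snd).inv.mul continuous_fst))
  have hFint : Integrable (fun p : G × C => conj (χ p.2) * f ((p.2 : G)⁻¹ * p.1)) (S.μ.prod ν) := by
    rw [integrable_prod_iff' hFc.aestronglyMeasurable]
    refine ⟨Filter.Eventually.of_forall fun κ => ?_, ?_⟩
    · show Integrable (fun x => conj (χ κ) * f ((κ : G)⁻¹ * x)) S.μ
      exact (hint.comp_mul_left ((κ : G)⁻¹)).const_mul _
    · have h : (fun κ : C => ∫ x, ‖conj (χ κ) * f ((κ : G)⁻¹ * x)‖ ∂S.μ) =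
          fun κ : C => ‖χ κ‖ * ∫ x, ‖f x‖ ∂S.μ := by
        funext κ
        simp only [norm_mul, RCLike.norm_conj]
        rw [integral_const_mul]
        congr 1
        exact integral_mul_left_eq_self (fun x => ‖f x‖) ((κ : G)⁻¹)
      rw [h]
      exact integrable_of_continuous_compact C ν (hχc.norm.mul continuous_const)
  rw [kProjL_eq]
  exact hFint.integral_prod_left

/-- the left projector of a continuous function is continuous (the reflection conjugate of `continuous_kProj`). -/
theorem continuous_kProjL [CompactSpace C] [IsFiniteMeasure ν] [LocallyCompactSpace G] [FirstCountableTopology G]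
    {χ : G → ℂ} (hχc : Continuous fun κ : C => χ κ) {f : G → ℂ} (hf : Continuous f) :
    Continuous (kProjL C ν χ f) :=
  (continuous_kProj C ν hχc (hf.comp continuous_inv)).comp continuous_inv

/-- **«continuous and integrable» passes through `biProj`**. -/
theorem isTestL1_biProj [SecondCountableTopology G] [SFinite S.μ] [CompactSpace C] [IsFiniteMeasure ν]
    [LocallyCompactSpace G] [FirstCountableTopology G] {χ : G → ℂ} (hχc : Continuous fun κ : C => χ κ)
    {f : G → ℂ} (hf : Continuous f) (hint : Integrable f S.μ) :
    Continuous (biProj C ν χ f) ∧ Integrable (biProj C ν χ f) S.μ := by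
  have hχc' : Continuous fun κ : C => conj (χ κ) := Complex.continuous_conj.comp hχc
  have hc : Continuous (kProj C ν (fun g => conj (χ g)) f) := continuous_kProj C ν hχc' hf
  have hi : Integrable (kProj C ν (fun g => conj (χ g)) f) S.μ := integrable_kProj S C ν hχc' hf hint
  exact ⟨continuous_kProjL C ν hχc hc, integrable_kProjL S C ν hχc hc hi⟩

end Projector

section ListComposite

variable {G : Type} [Group G] [TopologicalSpace G] [IsTopologicalGroup G] [MeasurableSpace G] [BorelSpace G]
  (S : RTF.Setting G)

/-- **«continuous and integrable» passes through the composite along a list of good data**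
(the `L¹` twin of `isTest_biProjList`). -/
theorem isTestL1_biProjList [SecondCountableTopology G] [SFinite S.μ] [LocallyCompactSpace G]
    [FirstCountableTopology G] (l : List (ProjDatum G)) (hl : ∀ d ∈ l, d.Good) {f : G → ℂ} (hf : Continuous f)
    (hint : Integrable f S.μ) : Continuous (biProjList l f) ∧ Integrable (biProjList l f) S.μ := by
  induction l with
  | nil => exact ⟨hf, hint⟩
  | cons d l ih =>
    have hd : d.Good := hl d (List.mem_cons_self ..)
    haveI : CompactSpace d.C := isCompact_iff_compactSpace.1 hd.compact
    haveI : IsFiniteMeasure d.ν := hd.finite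
    obtain ⟨hc, hi⟩ := ih fun d' hd' => hl d' (List.mem_cons_of_mem _ hd')
    exact isTestL1_biProj S d.C d.ν hd.cont hc hi

end ListComposite

section Instance

variable {k : Type} [Field k] [NumberField k] (W : PlaneData k) [MeasurableSpace (GA W)] [BorelSpace (GA W)]
  (q : QuadData k) (g g' : Matrix (Fin 4) (Fin 4) k) (eP' eM' : InfinitePlace k → ℤ)
  (ν : ∀ w : InfinitePlace k, Measure (localTorusAt' W w)) (K : Subgroup (GA W)) (νK : Measure K)

/-- **the `(τ′,K)`-projected function of a continuous integrable function is continuous and integrable**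
(«`projTest f₁ ∈ L¹`»). -/
theorem isTestL1_projTest (S : RTF.Setting (GA W)) [SFinite S.μ]
    (hgood : ∀ d ∈ projData W q g g' eP' eM' ν K νK, d.Good) {f : GA W → ℂ} (hf : Continuous f)
    (hint : Integrable f S.μ) :
    Continuous (projTest W q g g' eP' eM' ν K νK f) ∧ Integrable (projTest W q g g' eP' eM' ν K νK f) S.μ := by
  haveI := locallyCompact_GA W
  haveI := secondCountable_GA W
  exact isTestL1_biProjList S (projData W q g g' eP' eM' ν K νK) hgood hf hint

end Instance

end Summit.Ventures.HodgeRepro.Tier4.Line4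

end
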